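import Literature.AlgebraicGeometry.Deformation.MorphismLiftsSquareZeroSmoothAffine
import Mathlib.AlgebraicGeometry.Stalk
import Mathlib.CategoryTheory.Comma.Over.Basic
import HarnessLib

/-!
# Lifts across a nilpotent thickening of a LOCAL affine scheme into a SMOOTH target over an AFFINE base EXIST
# (SGA 1 III Cor. 5.2 / EGA IV₄ 17.1.1, one-point sources; the `Over S` form used by Artinian towers)

Layer `Literature/AlgebraicGeometry/Deformation`, namespace `Literature.AlgebraicGeometry.Deformation`.  THEOREMS ONLY
(no definition, no named fact, no instance).  Sequel of ★ `Deformation/MorphismLiftsSquareZeroSmoothAffine`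
(`exists_lift_of_smooth_affine`: for `p : X → Spec R₀` smooth, an affine open `V ⊆ X` and a surjection of `R₀`-algebras
`π : B → B₀` with nilpotent kernel, every `R₀`-morphism `Spec B₀ → X` LANDING IN `V` extends to `Spec B → X`), which reads
[SGA1, Exp. III Cor. 5.2] chart by chart.  This file removes the chart from the statement in the case the cell's Artinian
towers use ([MumfordAV1970] §13, proof of the Theorem p. 125: «since `X̂` is non-singular, `g` lifts to `R'`»):

* `exists_lift_of_smooth_of_isAffine` — for `f : X → S` SMOOTH with `S` AFFINE, `B₀` a LOCAL ring, `π : B → B₀` a surjective ring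
  map with NILPOTENT kernel, `b : Spec B → S` and `f₀ : Spec B₀ → X` with `f₀ ≫ f = Spec π ≫ b`, there is `g : Spec B → X` with
  `g ≫ f = b` and `Spec π ≫ g = f₀`.  Road: the closed point of `Spec B₀` maps into some affine open `V ⊆ X`, hence ALL of
  `Spec B₀` does (Mathlib `Scheme.preimage_eq_top_of_closedPoint_mem`); the base is `Spec Γ(S, ⊤)` along Mathlib's `S.isoSpec`,
  the scalar maps `Γ(S, ⊤) → B → B₀` come from `Spec.preimage`, and ★ `exists_lift_of_smooth_affine` supplies the lift;
* `exists_over_lift_of_smooth_of_isAffine` — the same in the language of `Over S`: for `Y : Over S` with `Y.hom` smooth, every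
  `g : Over.mk (Spec π ≫ c) ⟶ Y` extends along `ι : Over.mk (Spec π ≫ c) ⟶ Over.mk c` (`ι.left = Spec π`) to `g' : Over.mk c ⟶ Y`,
  `ι ≫ g' = g`;
* `isNilpotent_ker_of_ker_eq_span_of_mul_self_eq_zero` — a PRINCIPAL SMALL extension `q : C′ ↠ C` (`ker q = (t₀)`, `t₀² = 0`,
  e.g. `t₀ · 𝔪_{C′} = 0` with `t₀ ∈ 𝔪_{C′}`) has nilpotent (square-zero) kernel;
* `exists_over_lift_of_smooth_smallExtension` — `exists_over_lift_of_smooth_of_isAffine` along a principal small extension of a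
  local ring, hypotheses spelled exactly as in the cell's Artinian-tower letters (`q`, `t₀`, `ker q = span {t₀}`, `t₀ * t₀ = 0`,
  `c′ : Spec C′ → S`, `ι₀` with `ι₀.left = Spec q`).

Smoothness enters only through ★ `formallySmooth_sections_of_smooth` (Mathlib: `Smooth` is the `HasRingHomProperty` of
`RingHom.Smooth`; `Algebra.Smooth.formallySmooth`; `Algebra.FormallySmooth.liftOfSurjective`).  Compare ★
`Motives/SmoothThickeningLift.exists_lift_of_smooth_of_isNilpotent` (A-side M13 capital): the same lifting for a smooth
`Y → Spec K` over a FIELD `K`, through the formally smooth local ring `𝒪_{Y,y}`; here the base is any affine scheme.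
Mathlib searched: `AlgebraicGeometry.Smooth` (+ `smooth_comp`, isomorphisms are smooth via open immersions),
`Scheme.isoSpec`, `Spec.preimage` ∕ `Spec.map_preimage`, `Scheme.preimage_eq_top_of_closedPoint_mem`,
`exists_isAffineOpen_mem_and_subset`, `Over.homMk` ∕ `Over.w` ∕ `Over.OverMorphism.ext`; Mathlib has no scheme-level formal
smoothness ∕ infinitesimal-lifting statement (`AlgebraicGeometry/Morphisms/` has `Smooth`, `FormallyUnramified`, `Etale`).

Cell hodgecm-mathlib (D-0151), F-3 (Mc) N3′ letter S-a «LIFTS EXIST» of the Artinian tower under `stub_McN3`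
(`Cruxes/HDel/Lines/F3DualAbelianSchemeMc.lean`); count-neutral generic capital.  HC_CM is proved only modulo the 7 printed
citations until rung 0 closes; this file discharges none of them.

## References
* [SGA1] A. Grothendieck, M. Raynaud, *Revêtements étales et groupe fondamental (SGA 1)*, LNM 224 (1971) ∕ arXiv:math/0206203:
  Exp. III §5, Prop. 5.1 and Cor. 5.2.
* [EGAIV4] A. Grothendieck, EGA IV₄, Publ. Math. IHÉS 32 (1967): Déf. 17.1.1 (formally smooth: lifting along nilpotent
  thickenings of affine schemes), Déf. 17.3.1 and Prop. 17.1.6.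
* [StacksProject] Tags 02H6 (smooth ring maps are formally smooth), 02GZ (formally smooth morphisms of schemes).
* [MumfordAV1970] D. Mumford, *Abelian Varieties* (1970), §13, proof of the Theorem (pp. 125–126).
-/

universe u

open CategoryTheory CategoryTheory.Limits AlgebraicGeometry TopologicalSpace

noncomputable section

namespace Literature.AlgebraicGeometry.Deformation

/-- **Smooth ⇒ infinitesimal lifting for local points, over an affine base** ([SGA1] Exp. III Cor. 5.2; [EGAIV4]
Déf. 17.1.1 ∕ 17.3.1).  Let `f : X → S` be smooth with `S` affine, `B₀` a local ring, `π : B → B₀` a surjective ring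
homomorphism with nilpotent kernel (the thickening `Spec B₀ ↪ Spec B`), `b : Spec B → S`, and `f₀ : Spec B₀ → X` an
`S`-morphism (`f₀ ≫ f = Spec π ≫ b`).  Then `f₀` extends to `g : Spec B → X` over `S`: `g ≫ f = b`, `Spec π ≫ g = f₀`.
Proof: the closed point of `Spec B₀` maps into an affine open `V ⊆ X`, hence `f₀` lands in `V`
(Mathlib `Scheme.preimage_eq_top_of_closedPoint_mem`); read the base as `Spec Γ(S, ⊤)` (`S.isoSpec`), the scalar maps
`Γ(S, ⊤) → B → B₀` through `Spec.preimage`, and apply ★ `exists_lift_of_smooth_affine` on the chart `V`.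
[cite: SGA1, Exp. III §5 Cor. 5.2] [cite: EGAIV4, Déf. 17.1.1 and Déf. 17.3.1] [cite: StacksProject, Tag 02H6] -/
theorem exists_lift_of_smooth_of_isAffine {X S : Scheme.{u}} [IsAffine S] (f : X ⟶ S) [Smooth f]
    {B B₀ : Type u} [CommRing B] [CommRing B₀] [IsLocalRing B₀] (π : B →+* B₀)
    (hπ : Function.Surjective π) (hnil : IsNilpotent (RingHom.ker π))
    (b : Spec (.of B) ⟶ S) (f₀ : Spec (.of B₀) ⟶ X)
    (w : f₀ ≫ f = Spec.map (CommRingCat.ofHom π) ≫ b) :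
    ∃ g : Spec (.of B) ⟶ X, g ≫ f = b ∧ Spec.map (CommRingCat.ofHom π) ≫ g = f₀ := by
  -- the base read as `Spec R₀`, `R₀ := Γ(S, ⊤)`
  let p : X ⟶ Spec (.of Γ(S, ⊤)) := f ≫ S.isoSpec.hom
  haveI : Smooth p := inferInstance
  -- the scalar map of `b`
  let φ : CommRingCat.of ↑Γ(S, ⊤) ⟶ CommRingCat.of B := Spec.preimage (b ≫ S.isoSpec.hom)
  have hφ : Spec.map φ = b ≫ S.isoSpec.hom := Spec.map_preimage _
  letI : Algebra Γ(S, ⊤) B := φ.hom.toAlgebra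
  letI : Algebra Γ(S, ⊤) B₀ := (π.comp φ.hom).toAlgebra
  let πₐ : B →ₐ[Γ(S, ⊤)] B₀ := { π with commutes' := fun _ => rfl }
  have hnil' : IsNilpotent (RingHom.ker (πₐ : B →+* B₀)) := hnil
  -- an affine open of `X` through which `f₀` factors (the source has a unique closed point)
  obtain ⟨V, hV, hxV, -⟩ := exists_isAffineOpen_mem_and_subset (X := X) (U := ⊤)
    (Opens.mem_top (f₀.base (IsLocalRing.closedPoint B₀)))
  have hf₀ : f₀ ⁻¹ᵁ V = ⊤ := Scheme.preimage_eq_top_of_closedPoint_mem f₀ hxV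
  -- `f₀` is an `R₀`-morphism
  have w₀ : f₀ ≫ p = Spec.map (CommRingCat.ofHom (algebraMap Γ(S, ⊤) B₀)) := by
    change f₀ ≫ (f ≫ S.isoSpec.hom) = Spec.map (CommRingCat.ofHom (π.comp φ.hom))
    rw [← Category.assoc, w, Category.assoc, ← hφ, ← Spec.map_comp]
    rfl
  obtain ⟨g, -, hg₁, hg₂⟩ := exists_lift_of_smooth_affine p πₐ hV hπ hnil' f₀ w₀ hf₀
  refine ⟨g, ?_, hg₂⟩
  -- `g ≫ f ≫ S.isoSpec.hom = Spec (algebraMap) = Spec φ = b ≫ S.isoSpec.hom`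
  have h1 : (g ≫ f) ≫ S.isoSpec.hom = b ≫ S.isoSpec.hom := by
    rw [Category.assoc, ← hφ]
    exact hg₁
  exact (cancel_mono S.isoSpec.hom).mp h1

/-- **The `Over S` form** of `exists_lift_of_smooth_of_isAffine`: for `Y : Over S` with `Y.hom : Y.left → S` smooth
(`S` affine), a surjective ring map `π : B → B₀` onto a LOCAL ring with nilpotent kernel, an `S`-structure
`c : Spec B → S`, and a morphism of `S`-schemes `ι : Spec B₀ → Spec B` with `ι.left = Spec π` (the thickening), every
`S`-morphism `g : Spec B₀ → Y` extends along `ι`: `∃ g' : Over.mk c ⟶ Y, ι ≫ g' = g`.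
[cite: SGA1, Exp. III §5 Cor. 5.2] [cite: EGAIV4, Déf. 17.1.1 and Déf. 17.3.1] -/
theorem exists_over_lift_of_smooth_of_isAffine {S : Scheme.{u}} [IsAffine S] (Y : Over S) (hY : Smooth Y.hom)
    {B B₀ : Type u} [CommRing B] [CommRing B₀] [IsLocalRing B₀] (π : B →+* B₀)
    (hπ : Function.Surjective π) (hnil : IsNilpotent (RingHom.ker π)) (c : Spec (.of B) ⟶ S)
    (ι : Over.mk (Spec.map (CommRingCat.ofHom π) ≫ c) ⟶ Over.mk c)
    (hι : ι.left = Spec.map (CommRingCat.ofHom π))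
    (g : Over.mk (Spec.map (CommRingCat.ofHom π) ≫ c) ⟶ Y) :
    ∃ g' : Over.mk c ⟶ Y, ι ≫ g' = g := by
  haveI := hY
  -- `g` is an `S`-morphism: `g.left ≫ Y.hom = Spec π ≫ c` (`Over.w`, up to unfolding `Over.mk`)
  have wg : g.left ≫ Y.hom = Spec.map (CommRingCat.ofHom π) ≫ c := Over.w g
  obtain ⟨g₁, h₁, h₂⟩ := exists_lift_of_smooth_of_isAffine Y.hom π hπ hnil c g.left wg
  refine ⟨Over.homMk g₁ h₁, Over.OverMorphism.ext ?_⟩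
  -- `(ι ≫ g').left = ι.left ≫ g₁ = Spec π ≫ g₁ = g.left` (the objects `(Over.mk _).left` unfold to the spectra only at
  -- default transparency, so the rewriting is done by `congrArg`/`Eq.trans` rather than `rw`)
  have h₃ : ι.left ≫ g₁ = g.left := (congrArg (fun k => k ≫ g₁) hι).trans h₂
  exact h₃

/-- The kernel of a PRINCIPAL SMALL extension is nilpotent: if `ker q = (t₀)` and `t₀² = 0` (e.g. `t₀ ∈ 𝔪` and
`t₀ · 𝔪 = 0` in a local ring), then `(ker q)² = 0`. [cite: MumfordAV1970, §13 (proof of the Thm. p. 125)] -/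
theorem isNilpotent_ker_of_ker_eq_span_of_mul_self_eq_zero {C' C : Type u} [CommRing C'] [CommRing C]
    (q : C' →+* C) (t₀ : C') (hker₀ : RingHom.ker q = Ideal.span {t₀}) (ht₀ : t₀ * t₀ = 0) :
    IsNilpotent (RingHom.ker q) := by
  refine ⟨2, ?_⟩
  rw [hker₀, Ideal.span_singleton_pow, pow_two, ht₀, Ideal.zero_eq_bot, Ideal.span_singleton_eq_bot]

/-- **Lifts along a principal small extension of the base point exist** — `exists_over_lift_of_smooth_of_isAffine` with
the hypotheses spelled as in an Artinian tower ([MumfordAV1970] §13, proof of the Theorem p. 125: «since `X̂` is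
non-singular, `g` lifts to `R'`»): `Y : Over S` with `Y.hom` smooth and `S` affine; `q : C′ ↠ C` a surjective ring map
onto a LOCAL ring with `ker q = (t₀)`, `t₀² = 0`; `c′ : Spec C′ → S`; the thickening `ι₀ : Spec C → Spec C′` over `S`
(`ι₀.left = Spec q`).  Then every `g : Over.mk (Spec q ≫ c′) ⟶ Y` extends: `∃ g' : Over.mk c′ ⟶ Y, ι₀ ≫ g' = g`.
[cite: MumfordAV1970, §13 (proof of the Thm. p. 125)] [cite: SGA1, Exp. III §5 Cor. 5.2]
[cite: EGAIV4, Déf. 17.1.1 and Déf. 17.3.1] -/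
theorem exists_over_lift_of_smooth_smallExtension {S : Scheme.{u}} [IsAffine S] (Y : Over S) (hY : Smooth Y.hom)
    (C' C : Type u) [CommRing C'] [CommRing C] [IsLocalRing C]
    (q : C' →+* C) (hq : Function.Surjective q) (t₀ : C') (hker₀ : RingHom.ker q = Ideal.span {t₀})
    (ht₀ : t₀ * t₀ = 0) (c' : Spec (.of C') ⟶ S)
    (ι₀ : Over.mk (Spec.map (CommRingCat.ofHom q) ≫ c') ⟶ Over.mk c')
    (hι : ι₀.left = Spec.map (CommRingCat.ofHom q))
    (g : Over.mk (Spec.map (CommRingCat.ofHom q) ≫ c') ⟶ Y) :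
    ∃ g' : Over.mk c' ⟶ Y, ι₀ ≫ g' = g :=
  exists_over_lift_of_smooth_of_isAffine Y hY q hq
    (isNilpotent_ker_of_ker_eq_span_of_mul_self_eq_zero q t₀ hker₀ ht₀) c' ι₀ hι g

end Literature.AlgebraicGeometry.Deformation

end
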